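/-
Origin: expansion seat `planner-pub-hodgecm-toy-g2-0`, handover #3 2026-08-18T06:21:54Z (`HOME/pub-hodgecm-toy-g2/lean/ToyG2/Polarization.lean`, md5 e10f0ca3, 184 lines);
landed by the gen-6 packager in gate run 24 as `HodgeCM/Model/ToyG2/Polarization.lean` (verbatim).
-/
/-
Copyright: HodgeCMPerL referee-model cell (toy lineage, generation 2).  Lean 4 / Mathlib.
-/
import Mathlib
import Summits.HodgeConjecture.HodgeCM.CM.Basic

/-!
# ToyG2 — Riemann elements: every CM type is polarizable

For a CM field `F` and a CM type `Θ` of `F` there is `ξ ∈ F` with `ξ̄ = -ξ` and `Im θ(ξ) > 0` exactly for the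
embeddings `θ ∈ Θ` (`exists_riemannElement`).  The rational alternating form `E(x, y) = Tr_{F/ℚ}(ξ x ȳ)` is then a
Riemann form (polarization) of the weight-one Hodge structure `F_Θ` of the CM abelian variety `A_{(F,Θ)}` —
classical (Shimura–Taniyama; Milne, *Complex Multiplication* §1; Mumford, *Abelian Varieties* §22), proved here
from weak approximation at the archimedean places (Mathlib's `InfiniteAdeleRing.denseRange_algebraMap`, through
`HodgeCM.Literature.RealApproximation.denseRange_embeddings`… re-derived below to keep the import list at
`Mathlib` + `HodgeCM.CM.Basic`).

Also: totally real elements with any conjugation-invariant prescribed sign pattern (`exists_real_withSigns`) —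
the archimedean half of "`F⁺` has elements of every signature".

Role in the generation-2 programme (DESIGN.md §Ξ): positivity of the Gram/period form of a theta realisation
(`ThetaRealisation.inner_Λ`, `lineField`) is manufactured from these Riemann elements.

No placeholders, no new axioms.
-/

noncomputable section

namespace HodgeCM.ToyG2

open NumberField NumberField.InfinitePlace NumberField.ComplexEmbedding
open Literature.AlgebraicGeometry.ShimuraVarieties (conjRingHomK embedding_conjRingHomK)
open Literature.AlgebraicGeometry.Motives (CMType)

section Density

variable (K : Type*) [Field K] [NumberField K]

/-- Weak approximation at the infinite places, complex coordinates: `x ↦ (w.embedding x)_w` has dense range in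
`∏_{w complex} ℂ` (Mathlib `InfiniteAdeleRing.denseRange_algebraMap` transported along `ringEquiv_mixedSpace`). -/
theorem denseRange_complexEmbeddings' :
    DenseRange (fun x : K => fun w : {w : InfinitePlace K // w.IsComplex} => w.1.embedding x) := by
  have hc : Continuous (InfiniteAdeleRing.ringEquiv_mixedSpace K) := by
    refine Continuous.prodMk (continuous_pi fun v => ?_) (continuous_pi fun v => ?_)
    · exact (InfinitePlace.Completion.isometry_extensionEmbeddingOfIsReal v.2).continuous.comp
        (continuous_apply _)
    · exact (InfinitePlace.Completion.isometry_extensionEmbedding v.1).continuous.comp (continuous_apply _)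
  have heq : (mixedEmbedding K : K → mixedEmbedding.mixedSpace K) =
      (InfiniteAdeleRing.ringEquiv_mixedSpace K) ∘ (algebraMap K (InfiniteAdeleRing K)) := by
    funext x
    exact InfiniteAdeleRing.mixedEmbedding_eq_algebraMap_comp K
  have hd : DenseRange (mixedEmbedding K) := by
    rw [heq]
    exact (InfiniteAdeleRing.ringEquiv_mixedSpace K).surjective.denseRange.comp
      (InfiniteAdeleRing.denseRange_algebraMap K) hc
  have h := (Function.Surjective.denseRange (f := (Prod.snd : mixedEmbedding.mixedSpace K → _))
    Prod.snd_surjective).comp hd continuous_snd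
  convert h using 1
  funext x
  funext w
  simp [Function.comp]

/-- For a totally complex field: simultaneous approximation at ALL complex embeddings of any target vector that is
compatible with complex conjugation. -/
theorem exists_forall_norm_sub_lt [IsTotallyComplex K] (z : (K →+* ℂ) → ℂ)
    (hz : ∀ θ, z (conjugate θ) = starRingEnd ℂ (z θ)) {ε : ℝ} (hε : 0 < ε) :
    ∃ x : K, ∀ θ : K →+* ℂ, ‖θ x - z θ‖ < ε := by
  classical
  obtain ⟨x, hx⟩ := (denseRange_complexEmbeddings' K).exists_dist_lt
    (fun w : {w : InfinitePlace K // w.IsComplex} => z w.1.embedding) hε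
  refine ⟨x, fun θ => ?_⟩
  have hw : (InfinitePlace.mk θ).IsComplex := IsTotallyComplex.isComplex _
  have h1 := (dist_pi_lt_iff hε).mp hx ⟨InfinitePlace.mk θ, hw⟩
  rw [dist_comm, dist_eq_norm] at h1
  -- `h1 : ‖(mk θ).embedding x - z (mk θ).embedding‖ < ε`
  rcases embedding_mk_eq θ with h | h
  · simpa [h] using h1
  · simp only [h] at h1
    rw [hz θ, conjugate_coe_eq, ← map_sub, Complex.norm_conj] at h1
    exact h1

end Density

variable (F : CMField)

/-- (Ported verbatim from the HodgeCMPerL package; no docstring in the source.) -/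
theorem conjRingHomK_conjRingHomK (x : F) : conjRingHomK F (conjRingHomK F x) = x :=
  IsCMField.complexConj_apply_apply _ x

/-- **Riemann elements.** Every CM type `Θ` of a CM field `F` has a `ξ ∈ F` with `ξ̄ = -ξ`, `θ(ξ) ∈ iℝ` for every
complex embedding `θ`, and `Im θ(ξ) > 0 ⟺ θ ∈ Θ`.  (Hence `Tr_{F/ℚ}(ξ x ȳ)` polarizes the CM Hodge structure of
type `Θ`.) -/
theorem exists_riemannElement (Θ : CMType F) :
    ∃ ξ : F, conjRingHomK F ξ = -ξ ∧ ∀ θ : F →+* ℂ, (θ ξ).re = 0 ∧ (0 < (θ ξ).im ↔ θ ∈ Θ.1) := by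
  classical
  let z : (F →+* ℂ) → ℂ := fun θ => if θ ∈ Θ.1 then Complex.I else -Complex.I
  have hz : ∀ θ, z (conjugate θ) = starRingEnd ℂ (z θ) := by
    intro θ
    by_cases h : θ ∈ Θ.1
    · have h' : conjugate θ ∉ Θ.1 := (Θ.2 θ).mp h
      simp [z, h, h', Complex.conj_I]
    · have h' : conjugate θ ∈ Θ.1 := by
        by_contra hc
        exact h ((Θ.2 θ).mpr hc)
      simp [z, h, h', Complex.conj_I]
  obtain ⟨x, hx⟩ := exists_forall_norm_sub_lt F z hz one_pos
  refine ⟨x - conjRingHomK F x, ?_, fun θ => ?_⟩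
  · rw [map_sub, conjRingHomK_conjRingHomK, neg_sub]
  have hθ : θ (x - conjRingHomK F x) = θ x - starRingEnd ℂ (θ x) := by
    rw [map_sub, embedding_conjRingHomK]
  have him : |(θ x).im - (z θ).im| < 1 := by
    have := Complex.abs_im_le_norm (θ x - z θ)
    rw [Complex.sub_im] at this
    exact lt_of_le_of_lt this (hx θ)
  refine ⟨by simp [hθ, Complex.sub_re, Complex.conj_re], ?_⟩
  rw [hθ, Complex.sub_im, Complex.conj_im, sub_neg_eq_add]
  by_cases h : θ ∈ Θ.1
  · simp only [z, h, if_true, Complex.I_im] at him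
    refine ⟨fun _ => h, fun _ => ?_⟩
    have := (abs_lt.mp him).1
    linarith
  · simp only [z, h, if_false, Complex.neg_im, Complex.I_im] at him
    refine ⟨fun hp => ?_, fun hm => absurd hm h⟩
    have := (abs_lt.mp him).2
    linarith

/-- **Totally real elements of prescribed signature.** For every conjugation-invariant set `S` of complex embeddings
there is `a ∈ F` with `ā = a`, all `θ(a)` real and nonzero, and `θ(a) < 0 ⟺ θ ∈ S`. -/
theorem exists_real_withSigns (S : Set (F →+* ℂ)) (hS : ∀ θ, conjugate θ ∈ S ↔ θ ∈ S) :
    ∃ a : F, conjRingHomK F a = a ∧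
      ∀ θ : F →+* ℂ, (θ a).im = 0 ∧ (θ a).re ≠ 0 ∧ ((θ a).re < 0 ↔ θ ∈ S) := by
  classical
  let z : (F →+* ℂ) → ℂ := fun θ => if θ ∈ S then -1 else 1
  have hz : ∀ θ, z (conjugate θ) = starRingEnd ℂ (z θ) := by
    intro θ
    by_cases h : θ ∈ S
    · simp [z, h, (hS θ).mpr h]
    · have h' : conjugate θ ∉ S := fun hc => h ((hS θ).mp hc)
      simp [z, h, h']
  obtain ⟨x, hx⟩ := exists_forall_norm_sub_lt F z hz one_pos
  refine ⟨x + conjRingHomK F x, ?_, fun θ => ?_⟩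
  · rw [map_add, conjRingHomK_conjRingHomK, add_comm]
  have hθ : θ (x + conjRingHomK F x) = θ x + starRingEnd ℂ (θ x) := by
    rw [map_add, embedding_conjRingHomK]
  have hre : |(θ x).re - (z θ).re| < 1 := by
    have := Complex.abs_re_le_norm (θ x - z θ)
    rw [Complex.sub_re] at this
    exact lt_of_le_of_lt this (hx θ)
  refine ⟨by simp [hθ, Complex.add_im, Complex.conj_im], ?_, ?_⟩
  · rw [hθ, Complex.add_re, Complex.conj_re]
    by_cases h : θ ∈ S
    · simp only [z, h, if_true, Complex.neg_re, Complex.one_re] at hre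
      have := (abs_lt.mp hre).2
      intro h0; linarith
    · simp only [z, h, if_false, Complex.one_re] at hre
      have := (abs_lt.mp hre).1
      intro h0; linarith
  · rw [hθ, Complex.add_re, Complex.conj_re]
    by_cases h : θ ∈ S
    · simp only [z, h, if_true, Complex.neg_re, Complex.one_re] at hre
      refine ⟨fun _ => h, fun _ => ?_⟩
      have := (abs_lt.mp hre).2
      linarith
    · simp only [z, h, if_false, Complex.one_re] at hre
      refine ⟨fun hp => ?_, fun hm => absurd hm h⟩
      have := (abs_lt.mp hre).1
      linarith

/-- The set of embeddings lying over a given infinite place is conjugation-invariant (so `exists_real_withSigns`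
provides, for each place `v`, a totally real `π_v` negative at `v` and positive at every other place). -/
theorem conjugate_mem_placeOver_iff (v : InfinitePlace F) (θ : F →+* ℂ) :
    conjugate θ ∈ {θ' : F →+* ℂ | InfinitePlace.mk θ' = v} ↔ θ ∈ {θ' : F →+* ℂ | InfinitePlace.mk θ' = v} := by
  simp [mk_conjugate_eq]

/-- For each infinite place `v` of the CM field `F`: a totally real `π ∈ F` (`π̄ = π`, all `θ(π)` real, nonzero)
which is negative exactly at the embeddings over `v`. -/
theorem exists_real_neg_exactly_at (v : InfinitePlace F) :
    ∃ π : F, conjRingHomK F π = π ∧ ∀ θ : F →+* ℂ, (θ π).im = 0 ∧ (θ π).re ≠ 0 ∧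
      ((θ π).re < 0 ↔ InfinitePlace.mk θ = v) := by
  simpa using exists_real_withSigns F {θ' : F →+* ℂ | InfinitePlace.mk θ' = v}
    (conjugate_mem_placeOver_iff F v)

end HodgeCM.ToyG2

end
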